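import Literature.NumberTheory.GaloisRepresentations.PicardLambdaAdicRepChebotarev
import Literature.NumberTheory.GaloisRepresentations.AbsolutelyIrreducibleReduction
import Literature.NumberTheory.GaloisRepresentations.ResidualGaloisRep
import Summits.Langlands.Langlands.Theorems.PicardMuOrdinaryMuOrdinaryFamilyRTDictionary
import HarnessLib

/-!
# Route `PicardMuOrdinary`, crux `IrregularClassicality` (stmt-Langlands-13758): stub S3 of the line
# `slope-free-polarized-limit` — the residual twisted Picard trace at a good Frobenius

Stub S3 `stub_residualFrobTrace` of the checked skeleton r7 of the line `slope-free-polarized-limit`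
(lead prover-line-stmt-Langlands-13758-c14-0), VERBATIM the registered statement.

For a quartic `f ∈ ℤ[X]` separable over `ℚ`, `K = ℚ(ω) = CyclotomicField 3 ℚ`, a finite place `v ∤ 3`
of `K` at which `f mod v` is still a separable quartic, `ϖ ≡ 1 (mod 3)` in `𝓞 K`, `ι : ℚ̄₃ ≃ ℂ`,
`e : K → ℂ`, a prime `𝔓 ∣ v` of `ℤ̄_K` and an arithmetic Frobenius `Φ` at `𝔓`: the `3`-adic number
`ι⁻¹ e(a_v(f) ϖ)` lies in `ℤ̄₃` and its residue class in `ℤ̄₃/𝔪` is `#{roots of f_K in K̄ fixed by Φ} − 1`.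

**Proof.**
1. In `𝓞 K`: `a_v(f) ≡ #roots(f mod v) − 1 (mod 1 − ζ)` for a primitive cube root `ζ ∈ 𝓞 K`
   (tree `picardTrace_sub_card_roots_sub_one_mem_span`), `3 ∈ (1 − ζ)` (tree `three_mem_span_one_sub`)
   and `ϖ ≡ 1 (mod 3)`, so `a_v(f) ϖ ≡ #roots(f mod v) − 1 (mod 1 − ζ)`
   (`picardTrace_mul_sub_card_roots_sub_one_mem_span`).
2. `z ↦ ι⁻¹(e z)` maps `𝓞 K` into `ℤ̄₃ = {‖x‖ ≤ 1}` (algebraic integers have norm `≤ 1`, tree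
   `PadicAlgCl.norm_le_one_of_isIntegral`, `padicAlgCl_mem_valuationSubring_iff`), whence a ring hom
   `𝓞 K →+* ℤ̄₃` (`RingHom.codRestrict`).
3. The residue field `ℤ̄₃/𝔪` has characteristic `3` (tree `PadicAlgCl.charP_residueField`), so the image
   `ζ̄` of `ζ` satisfies `(ζ̄ − 1)³ = ζ̄³ − 1 = 0`, i.e. `ζ̄ = 1`: the residue map kills the ideal `(1 − ζ)`
   (`map_eq_of_sub_mem_span_one_sub`).
4. Dedekind's dictionary, counted (tree `roots_toFinset_card_eq_card_fixed`):
   `#roots(f mod v) = #Fix(Φ | roots of f_K in K̄)`.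

No definition is introduced.  References: Ireland–Rosen, *A Classical Introduction to Modern Number
Theory*, Ch. 9 §3; C. Upton, *Galois representations attached to Picard curves*, J. Algebra 322 (2009), §2.
-/

open Literature.NumberTheory.GaloisRepresentations Literature.NumberTheory.Automorphic
open scoped NumberField
open IsDedekindDomain NumberField Polynomial Field

-- `Summit.Langlands.Langlands.…` (summit = sub-problem name, D-0017 layout) trips `dupNamespace` on every decl.
set_option linter.dupNamespace false
set_option autoImplicit false

namespace Summit.Langlands.Langlands.Theorems.IrregularClassicality.SlopeFreePolarizedLimit

noncomputable section

/-! ## 1. Cube roots of unity die in characteristic `3` -/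

/-- **A cube root of unity maps to `1` in a field of characteristic `3`**: if `ζ³ = 1` in a commutative
ring `R` and `r : R → k` is a ring homomorphism into a field of characteristic `3`, then `r ζ = 1`, since
`(r ζ − 1)³ = (r ζ)³ − 1 = 0` (freshman's dream) and a field is reduced. [folklore] -/
theorem map_eq_one_of_pow_three_eq_one {R k : Type*} [CommRing R] [Field k] [CharP k 3] (r : R →+* k)
    {ζ : R} (hζ : ζ ^ 3 = 1) : r ζ = 1 := by
  have h3 : r ζ ^ 3 = 1 := by rw [← map_pow, hζ, map_one]
  have h0 : (r ζ - 1) ^ 3 = 0 := by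
    rw [sub_pow_char (p := 3) (r ζ) 1, h3, one_pow, sub_self]
  have h := (pow_eq_zero_iff (n := 3) (by norm_num)).1 h0
  rwa [sub_eq_zero] at h

/-- **A ring homomorphism into a field of characteristic `3` factors through `R / (1 − ζ)`** for any cube
root of unity `ζ ∈ R`: if `a ≡ b (mod 1 − ζ)` then `r a = r b`. [folklore] -/
theorem map_eq_of_sub_mem_span_one_sub {R k : Type*} [CommRing R] [Field k] [CharP k 3] (r : R →+* k)
    {ζ : R} (hζ : ζ ^ 3 = 1) {a b : R} (hab : a - b ∈ Ideal.span {1 - ζ}) : r a = r b := by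
  obtain ⟨c, hc⟩ := Ideal.mem_span_singleton'.1 hab
  rw [← sub_eq_zero, ← map_sub, ← hc, map_mul, map_sub, map_one,
    map_eq_one_of_pow_three_eq_one r hζ, sub_self, mul_zero]

/-! ## 2. `ι⁻¹ ∘ e` maps `𝓞 K` into `ℤ̄₃` -/

/-- Algebraic integers of `K = ℚ(ω)` land in `ℤ̄₃ = {‖x‖ ≤ 1} ⊂ ℚ̄₃` under `ι⁻¹ ∘ e`: `ι⁻¹(e z)` is
integral over `ℤ`, and the closed unit ball of `ℚ̄₃` is integrally closed
(tree `PadicAlgCl.norm_le_one_of_isIntegral`). [folklore] -/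
theorem iotaInv_embedding_mem_padicAlgClIntegers (ι : PadicAlgCl 3 ≃+* ℂ)
    (e : CyclotomicField 3 ℚ →+* ℂ) (z : 𝓞 (CyclotomicField 3 ℚ)) :
    ι.symm (e (z : CyclotomicField 3 ℚ)) ∈ padicAlgClIntegers 3 :=
  (padicAlgCl_mem_valuationSubring_iff 3 _).2
    (PadicAlgCl.norm_le_one_of_isIntegral 3
      (map_isIntegral_int (ι.symm.toRingHom.comp e) (RingOfIntegers.isIntegral_coe z)))

/-! ## 3. The congruence `a_v(f) ϖ ≡ #roots(f mod v) − 1 (mod 1 − ζ)` -/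

/-- **The twisted branch-point congruence**: for `v ∤ 3`, `f mod v ≠ 0`, `ϖ ≡ 1 (mod 3)` and a primitive
cube root `ζ ∈ 𝓞 K`, `a_v(f) ϖ ≡ #{x ∈ k_v : f̄(x) = 0} − 1 (mod 1 − ζ)` — from the tree's
`picardTrace_sub_card_roots_sub_one_mem_span` (`a_v(f) ≡ #roots − 1`) and `3 ∈ (1 − ζ)`
(`three_mem_span_one_sub`). [folklore] -/
theorem picardTrace_mul_sub_card_roots_sub_one_mem_span {ζ : 𝓞 (CyclotomicField 3 ℚ)}
    (hζ : IsPrimitiveRoot ζ 3) (f : ℤ[X]) {v : HeightOneSpectrum (𝓞 (CyclotomicField 3 ℚ))}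
    [DecidableEq (𝓞 (CyclotomicField 3 ℚ) ⧸ v.asIdeal)]
    (h3 : (3 : 𝓞 (CyclotomicField 3 ℚ)) ∉ v.asIdeal)
    (hf : f.map ((Ideal.Quotient.mk v.asIdeal).comp (algebraMap ℤ (𝓞 (CyclotomicField 3 ℚ)))) ≠ 0)
    {ϖ : 𝓞 (CyclotomicField 3 ℚ)} (hϖ : ϖ - 1 ∈ Ideal.span {(3 : 𝓞 (CyclotomicField 3 ℚ))}) :
    picardTrace f v * ϖ -
        (((f.map ((Ideal.Quotient.mk v.asIdeal).comp
            (algebraMap ℤ (𝓞 (CyclotomicField 3 ℚ))))).roots.toFinset.card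
              : 𝓞 (CyclotomicField 3 ℚ)) - 1) ∈ Ideal.span {1 - ζ} := by
  have h1 := picardTrace_sub_card_roots_sub_one_mem_span hζ f h3 hf
  have hle : Ideal.span {(3 : 𝓞 (CyclotomicField 3 ℚ))} ≤ Ideal.span {1 - ζ} :=
    (Ideal.span_singleton_le_iff_mem _).2 (three_mem_span_one_sub hζ)
  have hϖ' : ϖ - 1 ∈ Ideal.span {1 - ζ} := hle hϖ
  have heq : picardTrace f v * ϖ -
      (((f.map ((Ideal.Quotient.mk v.asIdeal).comp
          (algebraMap ℤ (𝓞 (CyclotomicField 3 ℚ))))).roots.toFinset.card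
            : 𝓞 (CyclotomicField 3 ℚ)) - 1) =
      picardTrace f v * (ϖ - 1) + (picardTrace f v -
        (((f.map ((Ideal.Quotient.mk v.asIdeal).comp
            (algebraMap ℤ (𝓞 (CyclotomicField 3 ℚ))))).roots.toFinset.card
              : 𝓞 (CyclotomicField 3 ℚ)) - 1)) := by
    ring
  rw [heq]
  exact Ideal.add_mem _ (Ideal.mul_mem_left _ _ hϖ') h1

/-! ## 4. The registered stub S3 -/

/-- **Stub S3 — the residual twisted Picard trace at a good Frobenius** (Upton 2009 §2; Ireland–Rosen Ch. 9 §3;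
Dedekind).  For a quartic `f ∈ ℤ[X]` separable over `ℚ`, `K = ℚ(ω)`, a place `v ∤ 3` at which `f mod v` is a separable
quartic, `ϖ ≡ 1 (mod 3)` in `𝓞 K`, `ι : ℚ̄₃ ≃ ℂ`, `e : K → ℂ`, a prime `𝔓 ∣ v` of `ℤ̄_K` and an arithmetic Frobenius
`Φ` at `𝔓`: the `3`-adic number `ι⁻¹ e(a_v(f) ϖ)` is integral and its residue class in `ℤ̄₃/𝔪` is
`#{roots of f_K in K̄ fixed by Φ} − 1`.  Proof: `a_v = −Σ_x χ_v(f̄(x)) ≡ #roots(f̄) − 1 (mod 1 − ζ)` (tree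
`picardTrace_sub_card_roots_sub_one_mem_span`), `3 ∈ (1 − ζ)`, `ϖ ≡ 1`; `ι⁻¹ e` maps `𝓞 K` into
`ℤ̄₃` (`PadicAlgCl.norm_le_one_of_isIntegral`) and `ζ` to `1` residually (characteristic `3`); and
`#roots(f̄ in k_v) = #Fix(Φ)` (tree `roots_toFinset_card_eq_card_fixed`). [folklore] -/
theorem stub_residualFrobTrace :
    ∀ (f : Polynomial ℤ), f.natDegree = 4 → (f.map (Int.castRingHom ℚ)).Separable →
    ∀ (ι : PadicAlgCl 3 ≃+* ℂ) (e : CyclotomicField 3 ℚ →+* ℂ) (ϖ : 𝓞 (CyclotomicField 3 ℚ)),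
      ϖ - 1 ∈ Ideal.span {(3 : 𝓞 (CyclotomicField 3 ℚ))} →
    ∀ (v : HeightOneSpectrum (𝓞 (CyclotomicField 3 ℚ))), (3 : 𝓞 (CyclotomicField 3 ℚ)) ∉ v.asIdeal →
      (f.map ((Ideal.Quotient.mk v.asIdeal).comp (algebraMap ℤ (𝓞 (CyclotomicField 3 ℚ))))).natDegree = 4 →
      (f.map ((Ideal.Quotient.mk v.asIdeal).comp (algebraMap ℤ (𝓞 (CyclotomicField 3 ℚ))))).Separable →
    ∀ (𝔓 : Ideal (absIntegers (𝓞 (CyclotomicField 3 ℚ)) (CyclotomicField 3 ℚ))), 𝔓 ∈ v.primesAbove →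
    ∀ (Φ : absoluteGaloisGroup (CyclotomicField 3 ℚ)), IsArithFrobAt (𝓞 (CyclotomicField 3 ℚ)) Φ 𝔓 →
      ∃ hx : ι.symm (e (↑(picardTrace f v * ϖ))) ∈ padicAlgClIntegers 3,
        IsLocalRing.residue (padicAlgClIntegers 3) ⟨ι.symm (e (↑(picardTrace f v * ϖ))), hx⟩ =
          (Nat.card {α : ((f.map (algebraMap ℤ (CyclotomicField 3 ℚ))).rootSet
              (AlgebraicClosure (CyclotomicField 3 ℚ))) // Φ • α = α} : padicAlgClResidueField 3) - 1 := by
  intro f h4 hsepQ ι e ϖ hϖ v h3 hdeg hsep 𝔓 h𝔓 Φ hΦ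
  classical
  obtain ⟨ζ, hζ⟩ := exists_isPrimitiveRoot_three_cyclotomicField
  have hf0 : f.map ((Ideal.Quotient.mk v.asIdeal).comp (algebraMap ℤ (𝓞 (CyclotomicField 3 ℚ)))) ≠ 0 := by
    intro h0
    rw [h0, natDegree_zero] at hdeg
    exact absurd hdeg (by norm_num)
  -- the congruence in `𝓞 K`, and Dedekind's dictionary for the root count
  have hcong := picardTrace_mul_sub_card_roots_sub_one_mem_span hζ f h3 hf0 hϖ
  rw [roots_toFinset_card_eq_card_fixed f h4 hsepQ hdeg hsep h𝔓 hΦ] at hcong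
  -- transport along the ring hom `j : 𝓞 K → ℤ̄₃`, `z ↦ ι⁻¹(e z)`, and reduce modulo `𝔪` (characteristic `3`)
  haveI : CharP (padicAlgClResidueField 3) 3 := PadicAlgCl.charP_residueField 3
  let j : 𝓞 (CyclotomicField 3 ℚ) →+* padicAlgClIntegers 3 :=
    (ι.symm.toRingHom.comp
        (e.comp (algebraMap (𝓞 (CyclotomicField 3 ℚ)) (CyclotomicField 3 ℚ)))).codRestrict
      (padicAlgClIntegers 3) (iotaInv_embedding_mem_padicAlgClIntegers ι e)
  refine ⟨iotaInv_embedding_mem_padicAlgClIntegers ι e _, ?_⟩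
  have hres := map_eq_of_sub_mem_span_one_sub ((IsLocalRing.residue (padicAlgClIntegers 3)).comp j)
    hζ.pow_eq_one hcong
  rw [RingHom.comp_apply, RingHom.comp_apply, map_sub, map_natCast, map_one] at hres
  exact hres

end

end Summit.Langlands.Langlands.Theorems.IrregularClassicality.SlopeFreePolarizedLimit
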